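import Literature.NumberTheory.Automorphic.UnitaryDepthZeroPieceStrataCountTransportRamified   -- ★ p847257 (this seat): part 1, `n_j(t) = n′_j(e t)` along the frame; brings ★ p847240 (`exists_residual_orthogonal_of_mem_glInt`, `redMat_placeForm_antidiagThree`), ★ p847117, ★ p846992
import Literature.NumberTheory.Automorphic.UnitaryLatticeTreeFixedCosetStrataCounts            -- ★ (this seat): part 2 generic, `ncard_fixedBy_quotient_{bd,deep,reg,rankOne,rankOne_not}_eq_ncard_selfDual_fixed`; brings ★ p847316 (bijection + label dictionary)
import HarnessLib

/-!
# «A1′ COUNT TRANSPORT», part 2 at the CM place: the five two-layer strata counts `n_j(t)` of ★ p847154 (over `Fix_t(G′_v ⧸ K′)`) ARE counts of `e t`-fixed SELF-DUAL LATTICES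
# of `(L_w³, σ_w, Φ₃)` with the (a2) labels — the COUNT CURRENCY of F0P3a-p01 (g16)'s (C5) heads (tame-ramified non-split place)

Topic `NumberTheory/Automorphic`; namespace `Literature.NumberTheory.Automorphic.UnitaryGroup`.  THEOREMS ONLY (no definition, no instance, no notation, no named fact, no `sorry`).
Hand F0P3a-p05 (g16), 2026-09-02.  Cell `pub/hodgecm-mathlib`, crux H413 = `stmt-HodgeConjecture-24833`; road «S3-ram» (LEAD F0P3a-plan (g12); owner∕table F0P3a-p06 (g15)); architect
A-p16 (g31) ROAD-P1ram v2 row «A1′ COUNT TRANSPORT» (p05).  PART 1 = ★ p847240 ∕ ★ p847257 (`G′_v`-cosets → cosets of the one-place model `U := U(σ_w, Φ₃)(L_w)` along the frame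
`e g = A·g_w·A⁻¹` of ★ p846897); PART 2 generic = ★ p847316 ∕ ★ `UnitaryLatticeTreeFixedCosetStrataCounts` (model cosets → fixed self-dual lattices); THIS FILE instantiates part 2 at
`K = L_w`, `σ = σ_w`, `H = Φ₃,w = placeForm Φ₃ w.1` (`= J₀` over `L_w`, ★ `placeForm_antidiagOne`) and composes with part 1.

THE MATHEMATICS ([Rogawski1990] §4.9 pp. 54–55, §14.2 p. 233; [Kottwitz1986] §3; [BruhatTits1972] §10).  §1 discharges the generic hypotheses at the place: the root `𝒪_w³` is self-dual
and `U` is transitive on self-dual lattices (★ `isSelfDualLattice_stdLattice_three_of_v`, ★ `exists_unitary_mapGL_stdLattice_eq_of_isSelfDualLattice_of_v_two`: `σ_w` an isometric involution,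
`|2|_w = 1`); NO TRANSVECTIONS: a residually unipotent `u ∈ U ∩ GL₃(𝒪_w)` has `rank(red u − 1) ≠ 1` (`red u ∈ O(J₀)(𝓀_w)` by ★ p847240 `exists_residual_orthogonal_of_mem_glInt`, then ★
`rank_sub_one_ne_one_of_mem_orthogonal`); `σ_w` is residually trivial at a ramified place (★ `valued_galAdicCompletionMap_sub_lt_one_of_ramified`); and a `v`-DEEP `t ∈ G′_v`
(`t_w ≡ 1 (ϖ_v)`, `|ϖ_v|_w = |ϖ|²`) has a normalised `v`-deep image `e t = A t_w A⁻¹` (`A ∈ GL₃(𝒪_w)`).  §2: the rank-one class constant — part 1 reads the class with the FRAME TWIST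
`c̄′ = red(−det H′_w)` on the left (`c̄′·zᵀ(J₀N)z = a²`), part 2 with a class constant `c` on the right (`zᵀ(J₀N)z = red c·a²`); they agree when `red c · red(−det H′_w) = 1`, e.g.
`c = (−det H′_w)⁻¹`.  §3: for `t ∈ G′_v` `v`-deep, **`n_j(t) = #{M ⊆ L_w³ : M self-dual for (σ_w, ϖ, Φ₃,w), (e t)·M = M, LABEL_j(M)}`** for `j ∈ {bd, 0, reg, 1□_c, ¬1□_c}`, the `n_j(t)` being
VERBATIM the strata counts of ★ p847154 `classOrbitalIntegral_eq_mul_sixStrata_of_vDeep_ramified` and the right-hand sides VERBATIM the COUNT CURRENCY of the (a2) sheet (★ p847249 §5 at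
`H := placeForm Φ₃ w.1`, `γ := e t`, `ϖ′ := ϖ⁻¹`).  ★ p847249 `ncard_selfDual_fixed_*_eq_of_formCongr` then moves these lattice counts to any congruent frame.
HONEST LABEL: HC_CM is proved only modulo the 2 remaining named inputs (hLiu418 24832, h413 24833) until rung 0 closes; measure-free group bookkeeping, no books consequence.

## References
* [Rogawski1990] J. D. Rogawski, *Automorphic Representations of Unitary Groups in Three Variables*, Ann. of Math. Stud. 123 (1990): §4.9 pp. 54–55; §14.2 p. 233; §3.9 p. 32.
* [Kottwitz1986] R. E. Kottwitz, *Base change for unit elements of Hecke algebras*, Compositio Math. 60 (1986): §3 (fixed points on the building; congruence filtration).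
* [BruhatTits1972] F. Bruhat, J. Tits, *Groupes réductifs sur un corps local I*, Publ. Math. IHÉS 41 (1972): §10 (self-dual lattice classes as vertices).
* [PlatonovRapinchuk1994] V. Platonov, A. Rapinchuk, *Algebraic Groups and Number Theory* (1994): §3.3, §5.1.
-/

set_option autoImplicit false

noncomputable section

open MeasureTheory Measure Set Filter Topology NumberField IsDedekindDomain Matrix ValuativeRel
open Literature.NumberTheory.Rogawski1990 Literature.NumberTheory.GaloisRepresentations Literature.NumberTheory.Automorphic.UnitaryGroup
open Literature.NumberTheory.Automorphic.IntegralReduction Literature.GroupTheory.SpecificGroups Literature.NumberTheory.Automorphic.UnitaryLatticeTree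
open Literature.NumberTheory.Automorphic.HermitianLattice
open scoped Matrix MatrixGroups ValuativeRel

namespace Literature.NumberTheory.Automorphic.UnitaryGroup

/-! ## §0 The rank-one class constant: frame twist on the left ↔ class constant on the right -/

section Class

variable {k : Type*} [Field k] {ι : Type*}

/-- `(∃ z a, a ≠ 0 ∧ d·V z = a²) ↔ (∃ z a, a ≠ 0 ∧ V z = c·a²)` when `c·d = 1`. [cite: Rogawski1990, §4.9 p. 55] -/
theorem exists_mul_eq_sq_iff_exists_eq_mul_sq_of_mul_eq_one {c d : k} (hcd : c * d = 1) (V : ι → k) :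
    (∃ (z : ι) (a : k), a ≠ 0 ∧ d * V z = a ^ 2) ↔ ∃ (z : ι) (a : k), a ≠ 0 ∧ V z = c * a ^ 2 := by
  constructor
  · rintro ⟨z, a, ha, h⟩
    refine ⟨z, a, ha, ?_⟩
    calc V z = c * (d * V z) := by rw [← mul_assoc, hcd, one_mul]
      _ = c * a ^ 2 := by rw [h]
  · rintro ⟨z, a, ha, h⟩
    refine ⟨z, a, ha, ?_⟩
    rw [h, ← mul_assoc, mul_comm d c, hcd, one_mul]

end Class

/-! ## §1 The generic hypotheses of part 2 at the place `w`: self-dual root, transitivity, no transvections, residual triviality, `v`-deep image -/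

section Place

variable (L : Type) [Field L] [NumberField L] [IsCMField L] (H' : Matrix (Fin 3) (Fin 3) L) {v : HeightOneSpectrum (𝓞 ↥(maximalRealSubfield L))}
  (w : PlacesOver L v) (hw : IsCMField.complexConj L • w.1 = w.1) (he : v.asIdeal.ramificationIdx' w.1.asIdeal ≠ 1)
  (hH'w : IsUnit (placeForm H' w.1)) (hH'i : hH'w.unit ∈ glInt 3 (w.1.adicCompletion L))
  (h2 : IsUnit (2 : 𝒪[(w.1.adicCompletion L)]))
  (ϖ : (w.1.adicCompletion L)) (hϖ : Valued.v ϖ = WithZero.exp (-1 : ℤ))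
  (A : GL (Fin 3) (w.1.adicCompletion L)) (hA : A ∈ glInt 3 (w.1.adicCompletion L))
  (hframe : (placeForm H' w.1) = (-(placeForm H' w.1).det) • formCongr (galAdicCompletionMap (L := L) (IsCMField.complexConj L) hw) A ((StdForm.antidiagonal 3).over (w.1.adicCompletion L)))
  (e : ↥(UnitaryGroup.«local» L (IsCMField.complexConj L) 3 H' v) ≃ₜ* ↥(unitaryGroupOfForm (galAdicCompletionMap (L := L) (IsCMField.complexConj L) hw) (placeForm (Matrix.of fun i j : Fin 3 => if i.val + j.val + 1 = 3 then (1 : L) else 0) w.1)))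
  (heA : ∀ g : ((cmDatum L 3 H').Local v), (((e g) : ↥(unitaryGroupOfForm (galAdicCompletionMap (L := L) (IsCMField.complexConj L) hw) (placeForm (Matrix.of fun i j : Fin 3 => if i.val + j.val + 1 = 3 then (1 : L) else 0) w.1))) : GL (Fin 3) (w.1.adicCompletion L)) =
    A * ((localNonsplitEquiv (IsCMField.complexConj L) H' (IsCMField.complexConj_ne_one L) w hw g).val : GL (Fin 3) (w.1.adicCompletion L)) * A⁻¹)
  (hK : ∀ g : ((cmDatum L 3 H').Local v), g ∈ (cmLocalIntegralLevel L 3 H' v) ↔ (((e g) : ↥(unitaryGroupOfForm (galAdicCompletionMap (L := L) (IsCMField.complexConj L) hw) (placeForm (Matrix.of fun i j : Fin 3 => if i.val + j.val + 1 = 3 then (1 : L) else 0) w.1))) : GL (Fin 3) (w.1.adicCompletion L)) ∈ glInt 3 (w.1.adicCompletion L))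

include hw hϖ in
/-- **THE ROOT `𝒪_w³` IS SELF-DUAL for `(σ_w, ϖ, Φ₃,w)`** (`Φ₃,w = J₀`, ★ `isSelfDualLattice_stdLattice_three_of_v`). [cite: BruhatTits1972, §10] -/
theorem isSelfDualLattice_stdLattice_placeForm_antidiagThree : IsSelfDualLattice (galAdicCompletionMap (L := L) (IsCMField.complexConj L) hw) ϖ (placeForm (Matrix.of fun i j : Fin 3 => if i.val + j.val + 1 = 3 then (1 : L) else 0) w.1) (stdLattice (w.1.adicCompletion L) 3) := by
  rw [placeForm_antidiagOne]
  exact isSelfDualLattice_stdLattice_three_of_v hϖ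

include hw hϖ h2 in
/-- **`U(σ_w, Φ₃)(L_w)` IS TRANSITIVE ON SELF-DUAL LATTICES** (`σ_w` an isometric involution, `|2|_w = 1`; ★ `exists_unitary_mapGL_stdLattice_eq_of_isSelfDualLattice_of_v_two`).
[cite: BruhatTits1972, §10] [cite: Rogawski1990, §4.9 p. 54] -/
theorem exists_unitary_mapGL_stdLattice_eq_placeForm_antidiagThree {M : Submodule (Valued.integer (w.1.adicCompletion L)) (Fin 3 → (w.1.adicCompletion L))} (hM : IsSelfDualLattice (galAdicCompletionMap (L := L) (IsCMField.complexConj L) hw) ϖ (placeForm (Matrix.of fun i j : Fin 3 => if i.val + j.val + 1 = 3 then (1 : L) else 0) w.1) M) :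
    ∃ u : ↥(unitaryGroupOfForm (galAdicCompletionMap (L := L) (IsCMField.complexConj L) hw) (placeForm (Matrix.of fun i j : Fin 3 => if i.val + j.val + 1 = 3 then (1 : L) else 0) w.1)), M = mapGL ((u : ↥(unitaryGroupOfForm (galAdicCompletionMap (L := L) (IsCMField.complexConj L) hw) (placeForm (Matrix.of fun i j : Fin 3 => if i.val + j.val + 1 = 3 then (1 : L) else 0) w.1))) : GL (Fin 3) (w.1.adicCompletion L)) (stdLattice (w.1.adicCompletion L) 3) := by
  have hσ : ∀ a, (galAdicCompletionMap (L := L) (IsCMField.complexConj L) hw) ((galAdicCompletionMap (L := L) (IsCMField.complexConj L) hw) a) = a := fun a =>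
    Liu2021.galAdicCompletionMap_galAdicCompletionMap_self (↥(maximalRealSubfield L)) L (IsCMField.complexConj L)
      (AlgEquiv.ext fun x => IsCMField.complexConj_apply_apply L x) hw a
  have hvσ : ∀ a, Valued.v ((galAdicCompletionMap (L := L) (IsCMField.complexConj L) hw) a) = Valued.v a := fun a => valued_galAdicCompletionMap (L := L) (IsCMField.complexConj L) hw a
  have h2v : Valued.v (2 : (w.1.adicCompletion L)) = 1 := by
    have h := ((Valuation.integer.integers (valuation (w.1.adicCompletion L))).isUnit_iff_valuation_eq_one).1 h2
    exact (v_eq_one_iff_valuation_eq_one _).2 h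
  rw [placeForm_antidiagOne] at hM ⊢
  exact exists_unitary_mapGL_stdLattice_eq_of_isSelfDualLattice_of_v_two hσ hvσ hϖ h2v hM

include hw he h2 in
set_option maxHeartbeats 800000 in
-- budget only: statement-heavy CM-place tokens.
/-- **NO TRANSVECTIONS IN `U ∩ GL₃(𝒪_w)`**: a residually unipotent `u ∈ U(σ_w, Φ₃) ∩ GL₃(𝒪_w)` has `rank(red u − 1) ≠ 1` (`red u ∈ O(J₀)(𝓀_w)`, ★ p847240; no unipotent of Jordan rank
`1` in `O₃`, ★ `rank_sub_one_ne_one_of_mem_orthogonal`, `2 ≠ 0` in `𝓀_w`). [cite: Rogawski1990, §3.9 p. 32] [cite: Kottwitz1986, §3] -/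
theorem rank_redMat_sub_one_ne_one_of_isNilpotent (u : ↥(unitaryGroupOfForm (galAdicCompletionMap (L := L) (IsCMField.complexConj L) hw) (placeForm (Matrix.of fun i j : Fin 3 => if i.val + j.val + 1 = 3 then (1 : L) else 0) w.1))) (hu : ((u : ↥(unitaryGroupOfForm (galAdicCompletionMap (L := L) (IsCMField.complexConj L) hw) (placeForm (Matrix.of fun i j : Fin 3 => if i.val + j.val + 1 = 3 then (1 : L) else 0) w.1))) : GL (Fin 3) (w.1.adicCompletion L)) ∈ glInt 3 (w.1.adicCompletion L)) (hnil : IsNilpotent (redMat (((u : ↥(unitaryGroupOfForm (galAdicCompletionMap (L := L) (IsCMField.complexConj L) hw) (placeForm (Matrix.of fun i j : Fin 3 => if i.val + j.val + 1 = 3 then (1 : L) else 0) w.1))) : GL (Fin 3) (w.1.adicCompletion L)) : Matrix (Fin 3) (Fin 3) (w.1.adicCompletion L)) - 1)) :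
    (redMat ((((u : ↥(unitaryGroupOfForm (galAdicCompletionMap (L := L) (IsCMField.complexConj L) hw) (placeForm (Matrix.of fun i j : Fin 3 => if i.val + j.val + 1 = 3 then (1 : L) else 0) w.1))) : GL (Fin 3) (w.1.adicCompletion L)) : Matrix (Fin 3) (Fin 3) (w.1.adicCompletion L))) - 1).rank ≠ 1 := by
  have h2k : (2 : 𝓀[(w.1.adicCompletion L)]) ≠ 0 := by
    have h := h2.map (IsLocalRing.residue 𝒪[(w.1.adicCompletion L)])
    rw [map_ofNat] at h
    exact h.ne_zero
  obtain ⟨g, hg, hgu, -⟩ := exists_residual_orthogonal_of_mem_glInt L w hw he hu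
  have h := rank_sub_one_ne_one_of_mem_orthogonal h2k hg (by rw [hgu]; exact hnil)
  rwa [hgu] at h

include hw he in
/-- **`σ_w` IS RESIDUALLY TRIVIAL** at a ramified place: `|σ_w x − x| < 1` on `𝒪_w` (★ `valued_galAdicCompletionMap_sub_lt_one_of_ramified`). [cite: Rogawski1990, §4.9 p. 54] -/
theorem valued_sigma_sub_self_lt_one (x : (w.1.adicCompletion L)) (hx : Valued.v x ≤ 1) : Valued.v ((galAdicCompletionMap (L := L) (IsCMField.complexConj L) hw) x - x) < 1 :=
  Liu2021.LemD1IndexedNonVacuityRamifiedConverse.valued_galAdicCompletionMap_sub_lt_one_of_ramified L (IsCMField.complexConj L) v (IsCMField.complexConj_ne_one L) w hw he x hx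

omit [IsCMField L] in
/-- `Φ₃,w` is an integral matrix (entries `0, 1`). [cite: Rogawski1990, §4.9 p. 54] -/
theorem isIntMatrix_placeForm_antidiagThree : IsIntMatrix (placeForm (Matrix.of fun i j : Fin 3 => if i.val + j.val + 1 = 3 then (1 : L) else 0) w.1) := by
  rw [placeForm_antidiagOne]; exact isIntMatrix_antidiagonal

include hw he hϖ hA heA in
set_option maxHeartbeats 800000 in
-- budget only: statement-heavy CM-place tokens.
/-- **A `v`-DEEP `t` HAS A NORMALISED `v`-DEEP IMAGE**: if `t_w ≡ 1 (ϖ_v)` (`|ϖ_v|_w = |ϖ|²` at a ramified `w`) then `e t = A t_w A⁻¹ ≡ 1 (ϖ²)`, i.e. `|ϖ⁻²(e t − 1)_{ab}| ≤ 1`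
(`A, A⁻¹` integral). [cite: Kottwitz1986, §3] [cite: Rogawski1990, §4.9 p. 54] -/
theorem vDeep_frame_of_vDeep (t : ((cmDatum L 3 H').Local v)) (htdeep : (∀ a b, Valued.v (((toPlace v w (HeckeCharacter.uniformizer ↥(maximalRealSubfield L) v : v.adicCompletion ↥(maximalRealSubfield L))) ^ 1)⁻¹ * ((((t).val : GL (Fin 3) (UnitaryGroup.LocalRing L v)).val.map (Pi.evalRingHom (fun w' : PlacesOver L v => w'.1.adicCompletion L) w)) a b - (1 : Matrix (Fin 3) (Fin 3) (w.1.adicCompletion L)) a b)) ≤ 1)) : (∀ a b, Valued.v (ϖ⁻¹ * (ϖ⁻¹ * ((((e t : ↥(unitaryGroupOfForm (galAdicCompletionMap (L := L) (IsCMField.complexConj L) hw) (placeForm (Matrix.of fun i j : Fin 3 => if i.val + j.val + 1 = 3 then (1 : L) else 0) w.1))) : GL (Fin 3) (w.1.adicCompletion L)) : Matrix (Fin 3) (Fin 3) (w.1.adicCompletion L)) - 1) a b)) ≤ 1) := by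
  have hc1 : IsCMField.complexConj L ≠ 1 := IsCMField.complexConj_ne_one L
  set P : (w.1.adicCompletion L) := (toPlace v w (HeckeCharacter.uniformizer ↥(maximalRealSubfield L) v : v.adicCompletion ↥(maximalRealSubfield L))) with hPdef
  have hP : Valued.v P = WithZero.exp (-2 : ℤ) := (valued_toPlace_uniformizer_of_ramified L (IsCMField.complexConj L) hc1 w hw he).1
  have hϖ2 : Valued.v ϖ * Valued.v ϖ = Valued.v P := by
    rw [hP, ← map_mul, ← pow_two, map_pow, hϖ, ← WithZero.exp_nsmul]; norm_num
  have hPne : P ≠ 0 := fun h0 => by rw [h0, map_zero] at hP; exact WithZero.coe_ne_zero hP.symm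
  -- `Y := P⁻¹ (t_w − 1)` is integral
  have hY : IsIntMatrix (P⁻¹ • ((((t).val : GL (Fin 3) (UnitaryGroup.LocalRing L v)).val.map (Pi.evalRingHom (fun w' : PlacesOver L v => w'.1.adicCompletion L) w)) - 1)) := fun a b => by
    rw [Matrix.smul_apply, smul_eq_mul, Matrix.sub_apply]
    have h := htdeep a b
    rwa [pow_one] at h
  have hAi : IsIntMatrix (A : Matrix (Fin 3) (Fin 3) (w.1.adicCompletion L)) := ((Literature.NumberTheory.Automorphic.mem_glInt_iff_forall_v_le_one A).1 hA).1
  have hAi' : IsIntMatrix (((A⁻¹ : GL (Fin 3) (w.1.adicCompletion L))) : Matrix (Fin 3) (Fin 3) (w.1.adicCompletion L)) := ((Literature.NumberTheory.Automorphic.mem_glInt_iff_forall_v_le_one A).1 hA).2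
  have hMe : (((e t : ↥(unitaryGroupOfForm (galAdicCompletionMap (L := L) (IsCMField.complexConj L) hw) (placeForm (Matrix.of fun i j : Fin 3 => if i.val + j.val + 1 = 3 then (1 : L) else 0) w.1))) : GL (Fin 3) (w.1.adicCompletion L)) : Matrix (Fin 3) (Fin 3) (w.1.adicCompletion L)) = (A : Matrix (Fin 3) (Fin 3) (w.1.adicCompletion L)) * (((t).val : GL (Fin 3) (UnitaryGroup.LocalRing L v)).val.map (Pi.evalRingHom (fun w' : PlacesOver L v => w'.1.adicCompletion L) w)) * (((A⁻¹ : GL (Fin 3) (w.1.adicCompletion L))) : Matrix (Fin 3) (Fin 3) (w.1.adicCompletion L)) := by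
    rw [heA t, Units.val_mul, Units.val_mul, ← coe_localNonsplitEquiv_apply L H' v w hw t]
  have hconj : P⁻¹ • ((((e t : ↥(unitaryGroupOfForm (galAdicCompletionMap (L := L) (IsCMField.complexConj L) hw) (placeForm (Matrix.of fun i j : Fin 3 => if i.val + j.val + 1 = 3 then (1 : L) else 0) w.1))) : GL (Fin 3) (w.1.adicCompletion L)) : Matrix (Fin 3) (Fin 3) (w.1.adicCompletion L)) - 1) = (A : Matrix (Fin 3) (Fin 3) (w.1.adicCompletion L)) * (P⁻¹ • ((((t).val : GL (Fin 3) (UnitaryGroup.LocalRing L v)).val.map (Pi.evalRingHom (fun w' : PlacesOver L v => w'.1.adicCompletion L) w)) - 1)) * (((A⁻¹ : GL (Fin 3) (w.1.adicCompletion L))) : Matrix (Fin 3) (Fin 3) (w.1.adicCompletion L)) := by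
    rw [hMe, Matrix.mul_smul, Matrix.smul_mul, Matrix.mul_sub, Matrix.sub_mul, Matrix.mul_one, Units.mul_inv]
  have hint : IsIntMatrix (P⁻¹ • ((((e t : ↥(unitaryGroupOfForm (galAdicCompletionMap (L := L) (IsCMField.complexConj L) hw) (placeForm (Matrix.of fun i j : Fin 3 => if i.val + j.val + 1 = 3 then (1 : L) else 0) w.1))) : GL (Fin 3) (w.1.adicCompletion L)) : Matrix (Fin 3) (Fin 3) (w.1.adicCompletion L)) - 1)) := by
    rw [hconj]; exact isIntMatrix_mul (isIntMatrix_mul hAi hY) hAi'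
  have hkey : Valued.v (ϖ⁻¹ * ϖ⁻¹) = Valued.v P⁻¹ := by rw [map_mul, map_inv₀, map_inv₀, ← mul_inv, hϖ2]
  intro a b
  have h := hint a b
  rw [Matrix.smul_apply, smul_eq_mul] at h
  rw [← mul_assoc, map_mul, hkey, ← map_mul]
  exact h

end Place

/-! ## §2 The five strata counts `n_j(t)` of ★ p847154 as fixed self-dual lattice counts in `(L_w³, σ_w, Φ₃)` -/

section Lattice

variable (L : Type) [Field L] [NumberField L] [IsCMField L] (H' : Matrix (Fin 3) (Fin 3) L) {v : HeightOneSpectrum (𝓞 ↥(maximalRealSubfield L))}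
  (w : PlacesOver L v) (hw : IsCMField.complexConj L • w.1 = w.1) (he : v.asIdeal.ramificationIdx' w.1.asIdeal ≠ 1)
  (hH'w : IsUnit (placeForm H' w.1)) (hH'i : hH'w.unit ∈ glInt 3 (w.1.adicCompletion L))
  (h2 : IsUnit (2 : 𝒪[(w.1.adicCompletion L)]))
  (ϖ : (w.1.adicCompletion L)) (hϖ : Valued.v ϖ = WithZero.exp (-1 : ℤ))
  (A : GL (Fin 3) (w.1.adicCompletion L)) (hA : A ∈ glInt 3 (w.1.adicCompletion L))
  (hframe : (placeForm H' w.1) = (-(placeForm H' w.1).det) • formCongr (galAdicCompletionMap (L := L) (IsCMField.complexConj L) hw) A ((StdForm.antidiagonal 3).over (w.1.adicCompletion L)))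
  (e : ↥(UnitaryGroup.«local» L (IsCMField.complexConj L) 3 H' v) ≃ₜ* ↥(unitaryGroupOfForm (galAdicCompletionMap (L := L) (IsCMField.complexConj L) hw) (placeForm (Matrix.of fun i j : Fin 3 => if i.val + j.val + 1 = 3 then (1 : L) else 0) w.1)))
  (heA : ∀ g : ((cmDatum L 3 H').Local v), (((e g) : ↥(unitaryGroupOfForm (galAdicCompletionMap (L := L) (IsCMField.complexConj L) hw) (placeForm (Matrix.of fun i j : Fin 3 => if i.val + j.val + 1 = 3 then (1 : L) else 0) w.1))) : GL (Fin 3) (w.1.adicCompletion L)) =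
    A * ((localNonsplitEquiv (IsCMField.complexConj L) H' (IsCMField.complexConj_ne_one L) w hw g).val : GL (Fin 3) (w.1.adicCompletion L)) * A⁻¹)
  (hK : ∀ g : ((cmDatum L 3 H').Local v), g ∈ (cmLocalIntegralLevel L 3 H' v) ↔ (((e g) : ↥(unitaryGroupOfForm (galAdicCompletionMap (L := L) (IsCMField.complexConj L) hw) (placeForm (Matrix.of fun i j : Fin 3 => if i.val + j.val + 1 = 3 then (1 : L) else 0) w.1))) : GL (Fin 3) (w.1.adicCompletion L)) ∈ glInt 3 (w.1.adicCompletion L))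

include hw he h2 hϖ hA heA hK in
set_option maxHeartbeats 1600000 in
-- budget only: statement-heavy CM-place tokens (two currencies).
/-- **A1′ part 2 (bd)**: for `t ∈ G′_v` `v`-deep, `n_bd(t) = #{M : M self-dual, (e t)M = M, ¬ (e t − 1)M ⊆ ϖM}`. [cite: Rogawski1990, §4.9 p. 55; §14.2 p. 233] [cite: Kottwitz1986, §3] -/
theorem ncard_fixedBy_bd_eq_ncard_selfDual_fixed_ramified (t : ((cmDatum L 3 H').Local v)) (htdeep : (∀ a b, Valued.v (((toPlace v w (HeckeCharacter.uniformizer ↥(maximalRealSubfield L) v : v.adicCompletion ↥(maximalRealSubfield L))) ^ 1)⁻¹ * ((((t).val : GL (Fin 3) (UnitaryGroup.LocalRing L v)).val.map (Pi.evalRingHom (fun w' : PlacesOver L v => w'.1.adicCompletion L) w)) a b - (1 : Matrix (Fin 3) (Fin 3) (w.1.adicCompletion L)) a b)) ≤ 1)) :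
    {q : (((cmDatum L 3 H').Local v) ⧸ cmLocalIntegralLevel L 3 H' v) | q ∈ MulAction.fixedBy (((cmDatum L 3 H').Local v) ⧸ cmLocalIntegralLevel L 3 H' v) t ∧ (redMat (((((q.out⁻¹ * t * q.out)).val : GL (Fin 3) (UnitaryGroup.LocalRing L v)).val.map (Pi.evalRingHom (fun w' : PlacesOver L v => w'.1.adicCompletion L) w))) - 1).rank = 2}.ncard =
      {M : Submodule (Valued.integer (w.1.adicCompletion L)) (Fin 3 → (w.1.adicCompletion L)) | IsSelfDualLattice (galAdicCompletionMap (L := L) (IsCMField.complexConj L) hw) ϖ (placeForm (Matrix.of fun i j : Fin 3 => if i.val + j.val + 1 = 3 then (1 : L) else 0) w.1) M ∧ mapGL ((e t : ↥(unitaryGroupOfForm (galAdicCompletionMap (L := L) (IsCMField.complexConj L) hw) (placeForm (Matrix.of fun i j : Fin 3 => if i.val + j.val + 1 = 3 then (1 : L) else 0) w.1))) : GL (Fin 3) (w.1.adicCompletion L)) M = M ∧ ¬ M.map ((Matrix.toLin' ((((e t : ↥(unitaryGroupOfForm (galAdicCompletionMap (L := L) (IsCMField.complexConj L) hw) (placeForm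 (Matrix.of fun i j : Fin 3 => if i.val + j.val + 1 = 3 then (1 : L) else 0) w.1))) : GL (Fin 3) (w.1.adicCompletion L)) : Matrix (Fin 3) (Fin 3) (w.1.adicCompletion L)) - 1)).restrictScalars (Valued.integer (w.1.adicCompletion L))) ≤ scaleLattice ϖ M}.ncard :=
  (ncard_fixedBy_bd_eq_of_frame L H' w hw he ϖ hϖ A hA e heA hK t).trans
    (ncard_fixedBy_quotient_bd_eq_ncard_selfDual_fixed (galAdicCompletionMap (L := L) (IsCMField.complexConj L) hw) hϖ (placeForm (Matrix.of fun i j : Fin 3 => if i.val + j.val + 1 = 3 then (1 : L) else 0) w.1)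
      (isSelfDualLattice_stdLattice_placeForm_antidiagThree L w hw ϖ hϖ)
      (fun _ hM => exists_unitary_mapGL_stdLattice_eq_placeForm_antidiagThree L w hw h2 ϖ hϖ hM) (e t)
      (vDeep_frame_of_vDeep L H' w hw he ϖ hϖ A hA e heA t htdeep)
      (fun u hu hnil => rank_redMat_sub_one_ne_one_of_isNilpotent L w hw he h2 u hu hnil))

include hw he h2 hϖ hA heA hK in
set_option maxHeartbeats 1600000 in
-- budget only: statement-heavy CM-place tokens (two currencies).
/-- **A1′ part 2 (0)**: `n_0(t) = #{M : M self-dual, (e t)M = M, (e t − 1)M ⊆ ϖ²M}`. [cite: Rogawski1990, §4.9 p. 55; §14.2 p. 233] [cite: Kottwitz1986, §3] -/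
theorem ncard_fixedBy_interior_zero_eq_ncard_selfDual_fixed_ramified (t : ((cmDatum L 3 H').Local v)) :
    {q : (((cmDatum L 3 H').Local v) ⧸ cmLocalIntegralLevel L 3 H' v) | q ∈ MulAction.fixedBy (((cmDatum L 3 H').Local v) ⧸ cmLocalIntegralLevel L 3 H' v) t ∧ ((redMat (((((q.out⁻¹ * t * q.out)).val : GL (Fin 3) (UnitaryGroup.LocalRing L v)).val.map (Pi.evalRingHom (fun w' : PlacesOver L v => w'.1.adicCompletion L) w))) - 1).rank = 0 ∧ (redMat (ϖ⁻¹ • (((((q.out⁻¹ * t * q.out)).val : GL (Fin 3) (UnitaryGroup.LocalRing L v)).val.map (Pi.evalRingHom (fun w' : PlacesOver L v => w'.1.adicCompletion L) w)) - 1))).rank = 0)}.ncard =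
      {M : Submodule (Valued.integer (w.1.adicCompletion L)) (Fin 3 → (w.1.adicCompletion L)) | IsSelfDualLattice (galAdicCompletionMap (L := L) (IsCMField.complexConj L) hw) ϖ (placeForm (Matrix.of fun i j : Fin 3 => if i.val + j.val + 1 = 3 then (1 : L) else 0) w.1) M ∧ mapGL ((e t : ↥(unitaryGroupOfForm (galAdicCompletionMap (L := L) (IsCMField.complexConj L) hw) (placeForm (Matrix.of fun i j : Fin 3 => if i.val + j.val + 1 = 3 then (1 : L) else 0) w.1))) : GL (Fin 3) (w.1.adicCompletion L)) M = M ∧ M.map ((Matrix.toLin' ((((e t : ↥(unitaryGroupOfForm (galAdicCompletionMap (L := L) (IsCMField.complexConj L) hw) (placeForm (Matrix.of fun i j : Fin 3 => if i.val + j.val + 1 = 3 then (1 : L) else 0) w.1))) : GL (Fin 3) (w.1.adicCompletion L)) : Matrix (Fin 3) (Fin 3) (w.1.adicCompletion L)) - 1)).restrictScalars (Valued.integer (w.1.adicCompletion L))) ≤ scaleLattice (ϖ ^ 2) M}.ncard :=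
  (ncard_fixedBy_interior_zero_eq_of_frame L H' w hw he ϖ hϖ A hA e heA hK t).trans
    (ncard_fixedBy_quotient_deep_eq_ncard_selfDual_fixed (galAdicCompletionMap (L := L) (IsCMField.complexConj L) hw) hϖ (placeForm (Matrix.of fun i j : Fin 3 => if i.val + j.val + 1 = 3 then (1 : L) else 0) w.1)
      (isSelfDualLattice_stdLattice_placeForm_antidiagThree L w hw ϖ hϖ)
      (fun _ hM => exists_unitary_mapGL_stdLattice_eq_placeForm_antidiagThree L w hw h2 ϖ hϖ hM) (e t))

include hw he h2 hϖ hA heA hK in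
set_option maxHeartbeats 1600000 in
-- budget only: statement-heavy CM-place tokens (two currencies).
/-- **A1′ part 2 (reg)**: for `t` `v`-deep, `n_reg(t) = #{M : M self-dual, (e t)M = M, (e t − 1)M ⊆ ϖM ∧ ¬ ⊆ ϖ²M ∧ ¬ (e t − 1)²M ⊆ ϖ³M}`.
[cite: Rogawski1990, §4.9 p. 55; §14.2 p. 233] [cite: Kottwitz1986, §3] -/
theorem ncard_fixedBy_interior_reg_eq_ncard_selfDual_fixed_ramified (t : ((cmDatum L 3 H').Local v)) (htdeep : (∀ a b, Valued.v (((toPlace v w (HeckeCharacter.uniformizer ↥(maximalRealSubfield L) v : v.adicCompletion ↥(maximalRealSubfield L))) ^ 1)⁻¹ * ((((t).val : GL (Fin 3) (UnitaryGroup.LocalRing L v)).val.map (Pi.evalRingHom (fun w' : PlacesOver L v => w'.1.adicCompletion L) w)) a b - (1 : Matrix (Fin 3) (Fin 3) (w.1.adicCompletion L)) a b)) ≤ 1)) :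
    {q : (((cmDatum L 3 H').Local v) ⧸ cmLocalIntegralLevel L 3 H' v) | q ∈ MulAction.fixedBy (((cmDatum L 3 H').Local v) ⧸ cmLocalIntegralLevel L 3 H' v) t ∧ ((redMat (((((q.out⁻¹ * t * q.out)).val : GL (Fin 3) (UnitaryGroup.LocalRing L v)).val.map (Pi.evalRingHom (fun w' : PlacesOver L v => w'.1.adicCompletion L) w))) - 1).rank = 0 ∧ (redMat (ϖ⁻¹ • (((((q.out⁻¹ * t * q.out)).val : GL (Fin 3) (UnitaryGroup.LocalRing L v)).val.map (Pi.evalRingHom (fun w' : PlacesOver L v => w'.1.adicCompletion L) w)) - 1))).rank = 2)}.ncard =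
      {M : Submodule (Valued.integer (w.1.adicCompletion L)) (Fin 3 → (w.1.adicCompletion L)) | IsSelfDualLattice (galAdicCompletionMap (L := L) (IsCMField.complexConj L) hw) ϖ (placeForm (Matrix.of fun i j : Fin 3 => if i.val + j.val + 1 = 3 then (1 : L) else 0) w.1) M ∧ mapGL ((e t : ↥(unitaryGroupOfForm (galAdicCompletionMap (L := L) (IsCMField.complexConj L) hw) (placeForm (Matrix.of fun i j : Fin 3 => if i.val + j.val + 1 = 3 then (1 : L) else 0) w.1))) : GL (Fin 3) (w.1.adicCompletion L)) M = M ∧ (M.map ((Matrix.toLin' ((((e t : ↥(unitaryGroupOfForm (galAdicCompletionMap (L := L) (IsCMField.complexConj L) hw) (placeForm (Matrix.of fun i j : Fin 3 => if i.val + j.val + 1 = 3 then (1 : L) else 0) w.1))) : GL (Fin 3) (w.1.adicCompletion L)) : Matrix (Fin 3) (Fin 3) (w.1.adicCompletion L)) - 1)).restrictScalars (Valued.integer (w.1.adicCompletion L))) ≤ scaleLattice ϖ M ∧ ¬ M.map ((Matrix.toLin' ((((e t : ↥(unitaryGroupOfForm (galAdicCompletionMap (L := L) (IsCMField.complexConj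 L) hw) (placeForm (Matrix.of fun i j : Fin 3 => if i.val + j.val + 1 = 3 then (1 : L) else 0) w.1))) : GL (Fin 3) (w.1.adicCompletion L)) : Matrix (Fin 3) (Fin 3) (w.1.adicCompletion L)) - 1)).restrictScalars (Valued.integer (w.1.adicCompletion L))) ≤ scaleLattice (ϖ ^ 2) M ∧ ¬ M.map ((Matrix.toLin' (((((e t : ↥(unitaryGroupOfForm (galAdicCompletionMap (L := L) (IsCMField.complexConj L) hw) (placeForm (Matrix.of fun i j : Fin 3 => if i.val + j.val + 1 = 3 then (1 : L) else 0) w.1))) : GL (Fin 3) (w.1.adicCompletion L)) : Matrix (Fin 3) (Fin 3) (w.1.adicCompletion L)) - 1) ^ 2)).restrictScalars (Valued.integer (w.1.adicCompletion L))) ≤ scaleLattice (ϖ ^ 3) M)}.ncard :=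
  (ncard_fixedBy_interior_reg_eq_of_frame L H' w hw he ϖ hϖ A hA e heA hK t).trans
    (ncard_fixedBy_quotient_reg_eq_ncard_selfDual_fixed (galAdicCompletionMap (L := L) (IsCMField.complexConj L) hw) hϖ (placeForm (Matrix.of fun i j : Fin 3 => if i.val + j.val + 1 = 3 then (1 : L) else 0) w.1)
      (isSelfDualLattice_stdLattice_placeForm_antidiagThree L w hw ϖ hϖ)
      (fun _ hM => exists_unitary_mapGL_stdLattice_eq_placeForm_antidiagThree L w hw h2 ϖ hϖ hM) (e t)
      (vDeep_frame_of_vDeep L H' w hw he ϖ hϖ A hA e heA t htdeep))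

include hw he hH'w hH'i h2 hϖ hA hframe heA hK in
set_option maxHeartbeats 1600000 in
-- budget only: statement-heavy CM-place tokens (two currencies).
/-- **A1′ part 2 (1□_c)**: for `t` `v`-deep and a class constant `c ∈ 𝒪_w` with `red c · red(−det H′_w) = 1` (part 1's frame twist),
`n_□(t) = #{M : M self-dual, (e t)M = M, LEV ϖ ∧ ¬ LEV ϖ² ∧ LEV₂ ϖ³ ∧ CLS c}` (the (a2) rank-one token at `ϖ′ = ϖ⁻¹`).
[cite: Rogawski1990, §4.9 p. 55; §14.2 p. 233; §3.9 p. 32] [cite: Kottwitz1986, §3] -/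
theorem ncard_fixedBy_interior_sq_eq_ncard_selfDual_fixed_ramified (t : ((cmDatum L 3 H').Local v)) (htdeep : (∀ a b, Valued.v (((toPlace v w (HeckeCharacter.uniformizer ↥(maximalRealSubfield L) v : v.adicCompletion ↥(maximalRealSubfield L))) ^ 1)⁻¹ * ((((t).val : GL (Fin 3) (UnitaryGroup.LocalRing L v)).val.map (Pi.evalRingHom (fun w' : PlacesOver L v => w'.1.adicCompletion L) w)) a b - (1 : Matrix (Fin 3) (Fin 3) (w.1.adicCompletion L)) a b)) ≤ 1))
    {c : (w.1.adicCompletion L)} (hc : Valued.v c ≤ 1) (hcd : red c * red (-((placeForm H' w.1)).det) = 1) :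
    {q : (((cmDatum L 3 H').Local v) ⧸ cmLocalIntegralLevel L 3 H' v) | q ∈ MulAction.fixedBy (((cmDatum L 3 H').Local v) ⧸ cmLocalIntegralLevel L 3 H' v) t ∧ ((redMat (((((q.out⁻¹ * t * q.out)).val : GL (Fin 3) (UnitaryGroup.LocalRing L v)).val.map (Pi.evalRingHom (fun w' : PlacesOver L v => w'.1.adicCompletion L) w))) - 1).rank = 0 ∧ (redMat (ϖ⁻¹ • (((((q.out⁻¹ * t * q.out)).val : GL (Fin 3) (UnitaryGroup.LocalRing L v)).val.map (Pi.evalRingHom (fun w' : PlacesOver L v => w'.1.adicCompletion L) w)) - 1))).rank = 1 ∧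
        ∃ (z : Fin 3 → 𝓀[(w.1.adicCompletion L)]) (a : 𝓀[(w.1.adicCompletion L)]), a ≠ 0 ∧ z ⬝ᵥ ((redMat (placeForm H' w.1) * redMat (ϖ⁻¹ • (((((q.out⁻¹ * t * q.out)).val : GL (Fin 3) (UnitaryGroup.LocalRing L v)).val.map (Pi.evalRingHom (fun w' : PlacesOver L v => w'.1.adicCompletion L) w)) - 1))) *ᵥ z) = a ^ 2)}.ncard =
      {M : Submodule (Valued.integer (w.1.adicCompletion L)) (Fin 3 → (w.1.adicCompletion L)) | IsSelfDualLattice (galAdicCompletionMap (L := L) (IsCMField.complexConj L) hw) ϖ (placeForm (Matrix.of fun i j : Fin 3 => if i.val + j.val + 1 = 3 then (1 : L) else 0) w.1) M ∧ mapGL ((e t : ↥(unitaryGroupOfForm (galAdicCompletionMap (L := L) (IsCMField.complexConj L) hw) (placeForm (Matrix.of fun i j : Fin 3 => if i.val + j.val + 1 = 3 then (1 : L) else 0) w.1))) : GL (Fin 3) (w.1.adicCompletion L)) M = M ∧ (M.map ((Matrix.toLin' ((((e t : ↥(unitaryGroupOfForm (galAdicCompletionMap (L := L) (IsCMField.complexConj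 L) hw) (placeForm (Matrix.of fun i j : Fin 3 => if i.val + j.val + 1 = 3 then (1 : L) else 0) w.1))) : GL (Fin 3) (w.1.adicCompletion L)) : Matrix (Fin 3) (Fin 3) (w.1.adicCompletion L)) - 1)).restrictScalars (Valued.integer (w.1.adicCompletion L))) ≤ scaleLattice ϖ M ∧ ¬ M.map ((Matrix.toLin' ((((e t : ↥(unitaryGroupOfForm (galAdicCompletionMap (L := L) (IsCMField.complexConj L) hw) (placeForm (Matrix.of fun i j : Fin 3 => if i.val + j.val + 1 = 3 then (1 : L) else 0) w.1))) : GL (Fin 3) (w.1.adicCompletion L)) : Matrix (Fin 3) (Fin 3) (w.1.adicCompletion L)) - 1)).restrictScalars (Valued.integer (w.1.adicCompletion L))) ≤ scaleLattice (ϖ ^ 2) M ∧ M.map ((Matrix.toLin' (((((e t : ↥(unitaryGroupOfForm (galAdicCompletionMap (L := L) (IsCMField.complexConj L) hw) (placeForm (Matrix.of fun i j : Fin 3 => if i.val + j.val + 1 = 3 then (1 : L) else 0) w.1))) : GL (Fin 3) (w.1.adicCompletion L)) : Matrix (Fin 3) (Fin 3) (w.1.adicCompletion L)) - 1) ^ 2)).restrictScalars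 (Valued.integer (w.1.adicCompletion L))) ≤ scaleLattice (ϖ ^ 3) M ∧ ∃ y ∈ M, ∃ a : (w.1.adicCompletion L), Valued.v a = 1 ∧ Valued.v (ϖ⁻¹ * pairing (galAdicCompletionMap (L := L) (IsCMField.complexConj L) hw) (placeForm (Matrix.of fun i j : Fin 3 => if i.val + j.val + 1 = 3 then (1 : L) else 0) w.1) y (((((e t : ↥(unitaryGroupOfForm (galAdicCompletionMap (L := L) (IsCMField.complexConj L) hw) (placeForm (Matrix.of fun i j : Fin 3 => if i.val + j.val + 1 = 3 then (1 : L) else 0) w.1))) : GL (Fin 3) (w.1.adicCompletion L)) : Matrix (Fin 3) (Fin 3) (w.1.adicCompletion L)) - 1) *ᵥ y) - c * a ^ 2) < 1)}.ncard := by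
  rw [ncard_fixedBy_interior_sq_eq_of_frame L H' w hw he hH'w hH'i ϖ hϖ A hA hframe e heA hK t]
  have hgen := ncard_fixedBy_quotient_rankOne_eq_ncard_selfDual_fixed (galAdicCompletionMap (L := L) (IsCMField.complexConj L) hw) hϖ (placeForm (Matrix.of fun i j : Fin 3 => if i.val + j.val + 1 = 3 then (1 : L) else 0) w.1)
      (isSelfDualLattice_stdLattice_placeForm_antidiagThree L w hw ϖ hϖ)
      (fun _ hM => exists_unitary_mapGL_stdLattice_eq_placeForm_antidiagThree L w hw h2 ϖ hϖ hM) (e t)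
      (vDeep_frame_of_vDeep L H' w hw he ϖ hϖ A hA e heA t htdeep)
      (fun a => valued_galAdicCompletionMap (L := L) (IsCMField.complexConj L) hw a) (valued_sigma_sub_self_lt_one L w hw he)
      (isIntMatrix_placeForm_antidiagThree L w) hc
  rw [redMat_placeForm_antidiagThree L w] at hgen
  rw [← hgen]
  congr 1
  ext q
  simp only [Set.mem_setOf_eq]
  refine and_congr_right fun _ => and_congr_right fun _ => and_congr_right fun _ => ?_
  exact exists_mul_eq_sq_iff_exists_eq_mul_sq_of_mul_eq_one hcd _

include hw he hH'w hH'i h2 hϖ hA hframe heA hK in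
set_option maxHeartbeats 1600000 in
-- budget only: statement-heavy CM-place tokens (two currencies).
/-- **A1′ part 2 (the complementary rank-one stratum)**: `n_¬□(t) = #{M : M self-dual, (e t)M = M, LEV ϖ ∧ ¬ LEV ϖ² ∧ LEV₂ ϖ³ ∧ ¬ CLS c}` (same `c`; by ★ p847189 the
complement of the class `c` on the rank-one locus is the class `εc`). [cite: Rogawski1990, §4.9 p. 55; §14.2 p. 233; §3.9 p. 32] [cite: Kottwitz1986, §3] -/
theorem ncard_fixedBy_interior_nonsq_eq_ncard_selfDual_fixed_ramified (t : ((cmDatum L 3 H').Local v)) (htdeep : (∀ a b, Valued.v (((toPlace v w (HeckeCharacter.uniformizer ↥(maximalRealSubfield L) v : v.adicCompletion ↥(maximalRealSubfield L))) ^ 1)⁻¹ * ((((t).val : GL (Fin 3) (UnitaryGroup.LocalRing L v)).val.map (Pi.evalRingHom (fun w' : PlacesOver L v => w'.1.adicCompletion L) w)) a b - (1 : Matrix (Fin 3) (Fin 3) (w.1.adicCompletion L)) a b)) ≤ 1))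
    {c : (w.1.adicCompletion L)} (hc : Valued.v c ≤ 1) (hcd : red c * red (-((placeForm H' w.1)).det) = 1) :
    {q : (((cmDatum L 3 H').Local v) ⧸ cmLocalIntegralLevel L 3 H' v) | q ∈ MulAction.fixedBy (((cmDatum L 3 H').Local v) ⧸ cmLocalIntegralLevel L 3 H' v) t ∧ ((redMat (((((q.out⁻¹ * t * q.out)).val : GL (Fin 3) (UnitaryGroup.LocalRing L v)).val.map (Pi.evalRingHom (fun w' : PlacesOver L v => w'.1.adicCompletion L) w))) - 1).rank = 0 ∧ (redMat (ϖ⁻¹ • (((((q.out⁻¹ * t * q.out)).val : GL (Fin 3) (UnitaryGroup.LocalRing L v)).val.map (Pi.evalRingHom (fun w' : PlacesOver L v => w'.1.adicCompletion L) w)) - 1))).rank = 1 ∧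
        ¬ ∃ (z : Fin 3 → 𝓀[(w.1.adicCompletion L)]) (a : 𝓀[(w.1.adicCompletion L)]), a ≠ 0 ∧ z ⬝ᵥ ((redMat (placeForm H' w.1) * redMat (ϖ⁻¹ • (((((q.out⁻¹ * t * q.out)).val : GL (Fin 3) (UnitaryGroup.LocalRing L v)).val.map (Pi.evalRingHom (fun w' : PlacesOver L v => w'.1.adicCompletion L) w)) - 1))) *ᵥ z) = a ^ 2)}.ncard =
      {M : Submodule (Valued.integer (w.1.adicCompletion L)) (Fin 3 → (w.1.adicCompletion L)) | IsSelfDualLattice (galAdicCompletionMap (L := L) (IsCMField.complexConj L) hw) ϖ (placeForm (Matrix.of fun i j : Fin 3 => if i.val + j.val + 1 = 3 then (1 : L) else 0) w.1) M ∧ mapGL ((e t : ↥(unitaryGroupOfForm (galAdicCompletionMap (L := L) (IsCMField.complexConj L) hw) (placeForm (Matrix.of fun i j : Fin 3 => if i.val + j.val + 1 = 3 then (1 : L) else 0) w.1))) : GL (Fin 3) (w.1.adicCompletion L)) M = M ∧ (M.map ((Matrix.toLin' ((((e t : ↥(unitaryGroupOfForm (galAdicCompletionMap (L := L) (IsCMField.complexConj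 L) hw) (placeForm (Matrix.of fun i j : Fin 3 => if i.val + j.val + 1 = 3 then (1 : L) else 0) w.1))) : GL (Fin 3) (w.1.adicCompletion L)) : Matrix (Fin 3) (Fin 3) (w.1.adicCompletion L)) - 1)).restrictScalars (Valued.integer (w.1.adicCompletion L))) ≤ scaleLattice ϖ M ∧ ¬ M.map ((Matrix.toLin' ((((e t : ↥(unitaryGroupOfForm (galAdicCompletionMap (L := L) (IsCMField.complexConj L) hw) (placeForm (Matrix.of fun i j : Fin 3 => if i.val + j.val + 1 = 3 then (1 : L) else 0) w.1))) : GL (Fin 3) (w.1.adicCompletion L)) : Matrix (Fin 3) (Fin 3) (w.1.adicCompletion L)) - 1)).restrictScalars (Valued.integer (w.1.adicCompletion L))) ≤ scaleLattice (ϖ ^ 2) M ∧ M.map ((Matrix.toLin' (((((e t : ↥(unitaryGroupOfForm (galAdicCompletionMap (L := L) (IsCMField.complexConj L) hw) (placeForm (Matrix.of fun i j : Fin 3 => if i.val + j.val + 1 = 3 then (1 : L) else 0) w.1))) : GL (Fin 3) (w.1.adicCompletion L)) : Matrix (Fin 3) (Fin 3) (w.1.adicCompletion L)) - 1) ^ 2)).restrictScalars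 (Valued.integer (w.1.adicCompletion L))) ≤ scaleLattice (ϖ ^ 3) M ∧ ¬ ∃ y ∈ M, ∃ a : (w.1.adicCompletion L), Valued.v a = 1 ∧ Valued.v (ϖ⁻¹ * pairing (galAdicCompletionMap (L := L) (IsCMField.complexConj L) hw) (placeForm (Matrix.of fun i j : Fin 3 => if i.val + j.val + 1 = 3 then (1 : L) else 0) w.1) y (((((e t : ↥(unitaryGroupOfForm (galAdicCompletionMap (L := L) (IsCMField.complexConj L) hw) (placeForm (Matrix.of fun i j : Fin 3 => if i.val + j.val + 1 = 3 then (1 : L) else 0) w.1))) : GL (Fin 3) (w.1.adicCompletion L)) : Matrix (Fin 3) (Fin 3) (w.1.adicCompletion L)) - 1) *ᵥ y) - c * a ^ 2) < 1)}.ncard := by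
  rw [ncard_fixedBy_interior_nonsq_eq_of_frame L H' w hw he hH'w hH'i ϖ hϖ A hA hframe e heA hK t]
  have hgen := ncard_fixedBy_quotient_rankOne_not_eq_ncard_selfDual_fixed (galAdicCompletionMap (L := L) (IsCMField.complexConj L) hw) hϖ (placeForm (Matrix.of fun i j : Fin 3 => if i.val + j.val + 1 = 3 then (1 : L) else 0) w.1)
      (isSelfDualLattice_stdLattice_placeForm_antidiagThree L w hw ϖ hϖ)
      (fun _ hM => exists_unitary_mapGL_stdLattice_eq_placeForm_antidiagThree L w hw h2 ϖ hϖ hM) (e t)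
      (vDeep_frame_of_vDeep L H' w hw he ϖ hϖ A hA e heA t htdeep)
      (fun a => valued_galAdicCompletionMap (L := L) (IsCMField.complexConj L) hw a) (valued_sigma_sub_self_lt_one L w hw he)
      (isIntMatrix_placeForm_antidiagThree L w) hc
  rw [redMat_placeForm_antidiagThree L w] at hgen
  rw [← hgen]
  congr 1
  ext q
  simp only [Set.mem_setOf_eq]
  refine and_congr_right fun _ => and_congr_right fun _ => and_congr_right fun _ => not_congr ?_
  exact exists_mul_eq_sq_iff_exists_eq_mul_sq_of_mul_eq_one hcd _

omit [IsCMField L] in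
include hH'i in
/-- **THE CANONICAL CLASS CONSTANT `c := (−det H′_w)⁻¹`**: `|c| ≤ 1` and `red c · red(−det H′_w) = 1` (`H′_w ∈ GL₃(𝒪_w)`, so `|det H′_w| = 1`) — it discharges the hypotheses
`hc`, `hcd` of the two rank-one counts above. [cite: Rogawski1990, §4.9 p. 55] -/
theorem v_inv_neg_det_placeForm_le_one_and_red_mul_eq_one :
    Valued.v ((-((placeForm H' w.1)).det)⁻¹) ≤ 1 ∧ red ((-((placeForm H' w.1)).det)⁻¹) * red (-((placeForm H' w.1)).det) = 1 := by
  have hdet : valuation (w.1.adicCompletion L) ((placeForm H' w.1)).det = 1 := by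
    have h := valuation_det_eq_one_of_mem_glInt hH'i
    rwa [hH'w.unit_spec] at h
  have hneg : valuation (w.1.adicCompletion L) (-((placeForm H' w.1)).det) = 1 := by rw [Valuation.map_neg, hdet]
  have hne : -((placeForm H' w.1)).det ≠ 0 := fun h0 => by rw [h0, map_zero] at hneg; exact zero_ne_one hneg
  have hinv : valuation (w.1.adicCompletion L) ((-((placeForm H' w.1)).det)⁻¹) = 1 := by rw [map_inv₀, hneg, inv_one]
  refine ⟨((v_eq_one_iff_valuation_eq_one _).2 hinv).le, ?_⟩
  rw [← red_mul ((Valuation.mem_integer_iff _ _).2 hinv.le) ((Valuation.mem_integer_iff _ _).2 hneg.le), inv_mul_cancel₀ hne, red_one]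

end Lattice


end Literature.NumberTheory.Automorphic.UnitaryGroup

end
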